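import Summits.QuantumFields.BalabanUV.InfraRed.StrongCouplingEightFifthsBrackets
import HarnessLib

/-!
# Strong-coupling front, rung F4(12/7) groundwork: the radial exponential moments of `SU(2)` bracketed on the range
`0 ≤ κ ≤ 12/7` and on the piece `8/5 ≤ κ ≤ 12/7` — observatory of the non-perturbative crossover; no mass-gap claim

IR-3 v2 TWO-FRONT CROSSOVER LEDGER, front SC (`β₀`), SU(2), `d = 4`, Wilson normalisation `β_W = 4/g²`.
ABSOLUTE RULE of this package: No internally-minted statement may enter as a cited fact. Every hypothesis is either
kernel-proved in this package or a verbatim quotation of a PUBLISHED theorem with page reference. The manuscript(s)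
under audit are NOT citable for their own disputed steps — they are the thing under adjudication; programme-internal
(2001/route/tribunal) claims are never citable.

WHAT THIS FILE DOES.  `StrongCouplingEightFifthsBrackets` brackets `Z = ∫ e^{κx₀} dσ`, `Z' = ∫ x₀ e^{κx₀} dσ` and the
ball moments `J(a,k) = ∫₀¹ r^a ∫ x₀^k e^{κ r x₀} dσ dr` on `0 ≤ κ ≤ 8/5` (tail constant `e^κ ≤ 5`).  The axial-gauge
door of the transfer-operator gap (`StrongCouplingSlabAxialClustering.su2_latticeMassGap_of_oneLinkKRModulusSU2_axial`,
window `14 · β_W · K₂ < 1`) stays open with the quarter modulus `K₂ = 1/4` up to Wilson `β_W < 2/7`, i.e. the one-link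
ball `‖B‖_op ≤ 3β_W/2 ≤ 3/7`, `κ = 4‖B‖ ≤ 12/7`.  This module supplies the brackets on that range with the SAME engine
(termwise Haar moments `m₀ … m₁₃`, Taylor tails `e^κ ≤ 28/5`):
* §1 `exp_le_twentyEightFifths`, the `κ`-form brackets `sphere_bracket127` ∕ `ball_bracket127` and the evaluated
  brackets `sphere_eval127` ∕ `ball_eval127` (`partial(t) ≤ J ≤ partial(12/7) + (28/5)(12/7)^N/N!` for
  `0 ≤ t ≤ κ ≤ 12/7`);
* §2 NUMERICAL brackets on the piece `8/5 ≤ κ ≤ 12/7` (lower partial sums at `8/5`, upper at `12/7`, `N = 10`):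
  `1356/1000 ≤ Z ≤ 1416/1000`, `492/1000 ≤ Z' ≤ 544/1000`, `307/1000 ≤ z_B ≤ 318/1000`, `m₂ ≤ 218/1000`,
  `78/1000 ≤ J41`, `J52 ≤ 68/1000`, `J72 ≤ 525/10000`, `J63 ≤ 343/10000`, `J74 ≤ 292/10000`;
* §3 the SYMBOLIC brackets of `Z, Z', z_B` on `[0, 12/7]` (tail `κ¹⁰/648000 = (28/5)κ¹⁰/10!`) and the NUMERICAL
  cancellation brackets they imply on the piece: `0 ≤ 4Z' − κZ + κ³Z/20 ≤ 107/1000`, `0 ≤ κZ − 4Z' ≤ 253/1000`,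
  `123/1000 ≤ Z − 4z_B`.
Consumers: the certificate piece (`StrongCouplingTwelveSeventhsCertificate`), the one-link covariance bound on
`‖B‖_op ≤ 3/7` (`StrongCouplingTwelveSeventhsCovariance`) and the quarter modulus up to `β_W ≤ 2/7`.

NOT CLAIMED: nothing here is a statement about measures on the lattice; no number of the ledger moves in this file;
no mass-gap claim.
-/

noncomputable section

open MeasureTheory Filter Finset Real intervalIntegral
open scoped NNReal Quaternion Matrix BigOperators Topology Nat
open Matrix Complex
open Literature.MathematicalPhysics.QuantumLattice (su2Quat)
open Literature.MathematicalPhysics.QuantumFieldTheory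
open Summit.QuantumFields.BalabanUV.InfraRed.StrongCouplingHaarMoments (hasSum_integral_pow_mul_exp)
open Summit.QuantumFields.BalabanUV.InfraRed.StrongCouplingBallSeries
open Summit.QuantumFields.BalabanUV.InfraRed.StrongCouplingBallCertificate (moment_table)
open Summit.QuantumFields.BalabanUV.InfraRed.StrongCouplingEightFifthsBrackets (partial_mono moment_twelve
  moment_thirteen)

namespace Summit.QuantumFields.BalabanUV.InfraRed.StrongCouplingTwelveSeventhsBrackets


/-! ## 1. Series brackets on `0 ≤ κ ≤ 12/7` -/

/-- `e^{6/7} ≤ 59/25` (Taylor with remainder, `Real.exp_bound'`). [folklore] -/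
theorem exp_six_sevenths_le : Real.exp (6 / 7) ≤ 59 / 25 := by
  have h := Real.exp_bound' (x := 6 / 7) (by norm_num) (by norm_num) (n := 5) (by norm_num)
  have hs : ∑ m ∈ range 5, (6 / 7 : ℝ) ^ m / m.factorial = 5647 / 2401 := by
    simp only [sum_range_succ, sum_range_zero, Nat.factorial]
    norm_num
  rw [hs] at h
  norm_num [Nat.factorial] at h
  linarith

/-- **`e^κ ≤ 28/5` on the range `κ ≤ 12/7`** (`e^{12/7} = (e^{6/7})² ≤ (59/25)² < 28/5`). [folklore] -/
theorem exp_le_twentyEightFifths {κ : ℝ} (hκ : κ ≤ 12 / 7) : Real.exp κ ≤ 28 / 5 := by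
  have h1 : Real.exp κ ≤ Real.exp (12 / 7) := Real.exp_le_exp.2 hκ
  have h2 : Real.exp (12 / 7) = Real.exp (6 / 7) * Real.exp (6 / 7) := by
    rw [← Real.exp_add]; norm_num
  have h3 := exp_six_sevenths_le
  have h4 : 0 ≤ Real.exp (6 / 7) := (Real.exp_pos _).le
  nlinarith

/-- The upper bracket as a function of `κ ∈ [0, 12/7]`: `S ≤ Σ_{n<N} x_n κ^n + (28/5) κ^N / N!`. [folklore] -/
theorem le_partial_add_of_hasSum127 {x : ℕ → ℝ} {κ S : ℝ} (hκ : 0 ≤ κ) (hκ' : κ ≤ 12 / 7)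
    (hx : ∀ n, x n ≤ 1 / n !) (h : HasSum (fun n => x n * κ ^ n) S) (N : ℕ) :
    S ≤ ∑ n ∈ range N, x n * κ ^ n + 28 / 5 * κ ^ N / N ! := by
  have h1 := le_partial_add_of_hasSum hκ hx h N
  have h3 : κ ^ N * Real.exp κ / N ! ≤ 28 / 5 * κ ^ N / N ! := by
    have hN : (0 : ℝ) < N ! := by positivity
    rw [div_le_div_iff₀ hN hN]
    refine mul_le_mul_of_nonneg_right ?_ hN.le
    rw [mul_comm]
    exact mul_le_mul_of_nonneg_right (exp_le_twentyEightFifths hκ') (pow_nonneg hκ N)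
  linarith

/-- Monotonicity of the evaluated bracket: `Σ_{n<N} x_n κ^n + (28/5)κ^N/N! ≤ Σ_{n<N} x_n K^n + (28/5)K^N/N!` for
`0 ≤ κ ≤ K`, `x_n ≥ 0`. [folklore] -/
theorem partial_add_mono127 {x : ℕ → ℝ} {κ K : ℝ} (hκ : 0 ≤ κ) (hκK : κ ≤ K) (hx0 : ∀ n, 0 ≤ x n) (N : ℕ) :
    ∑ n ∈ range N, x n * κ ^ n + 28 / 5 * κ ^ N / N ! ≤ ∑ n ∈ range N, x n * K ^ n + 28 / 5 * K ^ N / N ! := by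
  have h2 : ∑ n ∈ range N, x n * κ ^ n ≤ ∑ n ∈ range N, x n * K ^ n :=
    sum_le_sum fun n _ => mul_le_mul_of_nonneg_left (pow_le_pow_left₀ hκ hκK n) (hx0 n)
  have h3 : 28 / 5 * κ ^ N / N ! ≤ 28 / 5 * K ^ N / N ! :=
    div_le_div_of_nonneg_right (mul_le_mul_of_nonneg_left (pow_le_pow_left₀ hκ hκK N) (by norm_num))
      (by positivity)
  linarith

/-- **Two-sided bracket of an exponential (sphere) moment** on `0 ≤ κ ≤ 12/7`:
`Σ_{n<N} κ^n/n! m_{k+n} ≤ ∫ x₀^k e^{κ x₀} dσ ≤ (same sum) + (28/5) κ^N/N!`. [folklore] -/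
theorem sphere_bracket127 (k : ℕ) {κ : ℝ} (hκ : 0 ≤ κ) (hκ' : κ ≤ 12 / 7) (N : ℕ) :
    ∑ n ∈ range N, κ ^ n / n ! * ∫ g : Matrix.specialUnitaryGroup (Fin 2) ℂ, (su2Quat g).re ^ (k + n) ∂(haarProbability (Matrix.specialUnitaryGroup (Fin 2) ℂ))
      ≤ ∫ g : Matrix.specialUnitaryGroup (Fin 2) ℂ, (su2Quat g).re ^ k * Real.exp (κ * (su2Quat g).re) ∂(haarProbability (Matrix.specialUnitaryGroup (Fin 2) ℂ)) ∧
    ∫ g : Matrix.specialUnitaryGroup (Fin 2) ℂ, (su2Quat g).re ^ k * Real.exp (κ * (su2Quat g).re) ∂(haarProbability (Matrix.specialUnitaryGroup (Fin 2) ℂ))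
      ≤ ∑ n ∈ range N, κ ^ n / n ! * ∫ g : Matrix.specialUnitaryGroup (Fin 2) ℂ, (su2Quat g).re ^ (k + n) ∂(haarProbability (Matrix.specialUnitaryGroup (Fin 2) ℂ)) + 28 / 5 * κ ^ N / N ! := by
  have h := hasSum_integral_pow_mul_exp k κ
  have h' : HasSum (fun n : ℕ => (1 / (n ! * 1) * ∫ g : Matrix.specialUnitaryGroup (Fin 2) ℂ, (su2Quat g).re ^ (k + n) ∂(haarProbability (Matrix.specialUnitaryGroup (Fin 2) ℂ))) * κ ^ n)
      (∫ g : Matrix.specialUnitaryGroup (Fin 2) ℂ, (su2Quat g).re ^ k * Real.exp (κ * (su2Quat g).re) ∂(haarProbability (Matrix.specialUnitaryGroup (Fin 2) ℂ))) := by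
    convert h using 1; funext n; ring
  have hlo := partial_le_of_hasSum hκ (fun n => (coeff_mem k n le_rfl).1) h' N
  have hhi := le_partial_add_of_hasSum127 hκ hκ' (fun n => (coeff_mem k n le_rfl).2) h' N
  have e : ∑ n ∈ range N, (1 / (n ! * 1) * ∫ g : Matrix.specialUnitaryGroup (Fin 2) ℂ, (su2Quat g).re ^ (k + n) ∂(haarProbability (Matrix.specialUnitaryGroup (Fin 2) ℂ))) * κ ^ n =
      ∑ n ∈ range N, κ ^ n / n ! * ∫ g : Matrix.specialUnitaryGroup (Fin 2) ℂ, (su2Quat g).re ^ (k + n) ∂(haarProbability (Matrix.specialUnitaryGroup (Fin 2) ℂ)) := sum_congr rfl fun n _ => by ring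
  rw [e] at hlo hhi
  exact ⟨hlo, hhi⟩

/-- **Evaluated sphere bracket**: for `0 ≤ t ≤ κ ≤ 12/7`,
`Σ_{n<N} t^n/n! m_{k+n} ≤ ∫ x₀^k e^{κ x₀} dσ ≤ Σ_{n<N} (12/7)^n/n! m_{k+n} + (28/5) (12/7)^N/N!`. [folklore] -/
theorem sphere_eval127 (k : ℕ) {t κ : ℝ} (ht : 0 ≤ t) (htκ : t ≤ κ) (hκ' : κ ≤ 12 / 7) (N : ℕ) :
    ∑ n ∈ range N, t ^ n / n ! * ∫ g : Matrix.specialUnitaryGroup (Fin 2) ℂ, (su2Quat g).re ^ (k + n) ∂(haarProbability (Matrix.specialUnitaryGroup (Fin 2) ℂ))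
      ≤ ∫ g : Matrix.specialUnitaryGroup (Fin 2) ℂ, (su2Quat g).re ^ k * Real.exp (κ * (su2Quat g).re) ∂(haarProbability (Matrix.specialUnitaryGroup (Fin 2) ℂ)) ∧
    ∫ g : Matrix.specialUnitaryGroup (Fin 2) ℂ, (su2Quat g).re ^ k * Real.exp (κ * (su2Quat g).re) ∂(haarProbability (Matrix.specialUnitaryGroup (Fin 2) ℂ))
      ≤ ∑ n ∈ range N, (12 / 7 : ℝ) ^ n / n ! * ∫ g : Matrix.specialUnitaryGroup (Fin 2) ℂ, (su2Quat g).re ^ (k + n) ∂(haarProbability (Matrix.specialUnitaryGroup (Fin 2) ℂ)) + 28 / 5 * (12 / 7) ^ N / N ! := by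
  have hκ : 0 ≤ κ := ht.trans htκ
  obtain ⟨hlo, hhi⟩ := sphere_bracket127 k hκ hκ' N
  have hx0 : ∀ n : ℕ, 0 ≤ 1 / (n ! * 1) * ∫ g : Matrix.specialUnitaryGroup (Fin 2) ℂ, (su2Quat g).re ^ (k + n) ∂(haarProbability (Matrix.specialUnitaryGroup (Fin 2) ℂ)) :=
    fun n => (coeff_mem k n le_rfl).1
  have h1 := partial_mono ht htκ hx0 N
  have h2 := partial_add_mono127 hκ hκ' hx0 N
  have e : ∀ s : ℝ, ∑ n ∈ range N, (1 / (n ! * 1) * ∫ g : Matrix.specialUnitaryGroup (Fin 2) ℂ, (su2Quat g).re ^ (k + n) ∂(haarProbability (Matrix.specialUnitaryGroup (Fin 2) ℂ))) * s ^ n =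
      ∑ n ∈ range N, s ^ n / n ! * ∫ g : Matrix.specialUnitaryGroup (Fin 2) ℂ, (su2Quat g).re ^ (k + n) ∂(haarProbability (Matrix.specialUnitaryGroup (Fin 2) ℂ)) :=
    fun s => sum_congr rfl fun n _ => by ring
  rw [e, e] at h1 h2
  exact ⟨h1.trans hlo, hhi.trans h2⟩

/-- **Two-sided bracket of a ball moment** on `0 ≤ κ ≤ 12/7`:
`Σ_{n<N} κ^n/(n!(n+a+1)) m_{k+n} ≤ ∫₀¹ r^a ∫ x₀^k e^{κ r x₀} dσ dr ≤ (same sum) + (28/5) κ^N/N!`. [folklore] -/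
theorem ball_bracket127 (k a : ℕ) {κ : ℝ} (hκ : 0 ≤ κ) (hκ' : κ ≤ 12 / 7) (N : ℕ) :
    ∑ n ∈ range N, κ ^ n / (n ! * (n + a + 1)) * ∫ g : Matrix.specialUnitaryGroup (Fin 2) ℂ, (su2Quat g).re ^ (k + n) ∂(haarProbability (Matrix.specialUnitaryGroup (Fin 2) ℂ))
      ≤ ∫ r in (0:ℝ)..1, r ^ a * ∫ g : Matrix.specialUnitaryGroup (Fin 2) ℂ, (su2Quat g).re ^ k * Real.exp (κ * r * (su2Quat g).re) ∂(haarProbability (Matrix.specialUnitaryGroup (Fin 2) ℂ)) ∧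
    ∫ r in (0:ℝ)..1, r ^ a * ∫ g : Matrix.specialUnitaryGroup (Fin 2) ℂ, (su2Quat g).re ^ k * Real.exp (κ * r * (su2Quat g).re) ∂(haarProbability (Matrix.specialUnitaryGroup (Fin 2) ℂ))
      ≤ ∑ n ∈ range N, κ ^ n / (n ! * (n + a + 1)) * ∫ g : Matrix.specialUnitaryGroup (Fin 2) ℂ, (su2Quat g).re ^ (k + n) ∂(haarProbability (Matrix.specialUnitaryGroup (Fin 2) ℂ))
        + 28 / 5 * κ ^ N / N ! := by
  have h := hasSum_ball k a κ
  have h' : HasSum (fun n : ℕ => (1 / (n ! * (n + a + 1)) * ∫ g : Matrix.specialUnitaryGroup (Fin 2) ℂ, (su2Quat g).re ^ (k + n) ∂(haarProbability (Matrix.specialUnitaryGroup (Fin 2) ℂ))) * κ ^ n)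
      (∫ r in (0:ℝ)..1, r ^ a * ∫ g : Matrix.specialUnitaryGroup (Fin 2) ℂ, (su2Quat g).re ^ k * Real.exp (κ * r * (su2Quat g).re) ∂(haarProbability (Matrix.specialUnitaryGroup (Fin 2) ℂ))) := by
    convert h using 1; funext n; ring
  have hw : ∀ n : ℕ, (1 : ℝ) ≤ n + a + 1 := fun n => by
    linarith [(Nat.cast_nonneg n : (0:ℝ) ≤ n), (Nat.cast_nonneg a : (0:ℝ) ≤ a)]
  have hlo := partial_le_of_hasSum hκ (fun n => (coeff_mem k n (hw n)).1) h' N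
  have hhi := le_partial_add_of_hasSum127 hκ hκ' (fun n => (coeff_mem k n (hw n)).2) h' N
  have e : ∑ n ∈ range N, (1 / (n ! * (n + a + 1)) * ∫ g : Matrix.specialUnitaryGroup (Fin 2) ℂ, (su2Quat g).re ^ (k + n) ∂(haarProbability (Matrix.specialUnitaryGroup (Fin 2) ℂ))) * κ ^ n =
      ∑ n ∈ range N, κ ^ n / (n ! * (n + a + 1)) * ∫ g : Matrix.specialUnitaryGroup (Fin 2) ℂ, (su2Quat g).re ^ (k + n) ∂(haarProbability (Matrix.specialUnitaryGroup (Fin 2) ℂ)) :=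
    sum_congr rfl fun n _ => by ring
  rw [e] at hlo hhi
  exact ⟨hlo, hhi⟩

/-- **Evaluated ball bracket**: for `0 ≤ t ≤ κ ≤ 12/7`,
`Σ_{n<N} t^n/(n!(n+a+1)) m_{k+n} ≤ ∫₀¹ r^a ∫ x₀^k e^{κ r x₀} dσ dr ≤ Σ_{n<N} (12/7)^n/(n!(n+a+1)) m_{k+n} + (28/5)(12/7)^N/N!`.
[folklore] -/
theorem ball_eval127 (k a : ℕ) {t κ : ℝ} (ht : 0 ≤ t) (htκ : t ≤ κ) (hκ' : κ ≤ 12 / 7) (N : ℕ) :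
    ∑ n ∈ range N, t ^ n / (n ! * (n + a + 1)) * ∫ g : Matrix.specialUnitaryGroup (Fin 2) ℂ, (su2Quat g).re ^ (k + n) ∂(haarProbability (Matrix.specialUnitaryGroup (Fin 2) ℂ))
      ≤ ∫ r in (0:ℝ)..1, r ^ a * ∫ g : Matrix.specialUnitaryGroup (Fin 2) ℂ, (su2Quat g).re ^ k * Real.exp (κ * r * (su2Quat g).re) ∂(haarProbability (Matrix.specialUnitaryGroup (Fin 2) ℂ)) ∧
    ∫ r in (0:ℝ)..1, r ^ a * ∫ g : Matrix.specialUnitaryGroup (Fin 2) ℂ, (su2Quat g).re ^ k * Real.exp (κ * r * (su2Quat g).re) ∂(haarProbability (Matrix.specialUnitaryGroup (Fin 2) ℂ))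
      ≤ ∑ n ∈ range N, (12 / 7 : ℝ) ^ n / (n ! * (n + a + 1)) * ∫ g : Matrix.specialUnitaryGroup (Fin 2) ℂ, (su2Quat g).re ^ (k + n) ∂(haarProbability (Matrix.specialUnitaryGroup (Fin 2) ℂ))
        + 28 / 5 * (12 / 7) ^ N / N ! := by
  have hκ : 0 ≤ κ := ht.trans htκ
  obtain ⟨hlo, hhi⟩ := ball_bracket127 k a hκ hκ' N
  have hw : ∀ n : ℕ, (1 : ℝ) ≤ n + a + 1 := fun n => by
    linarith [(Nat.cast_nonneg n : (0:ℝ) ≤ n), (Nat.cast_nonneg a : (0:ℝ) ≤ a)]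
  have hx0 : ∀ n : ℕ, 0 ≤ 1 / (n ! * (n + a + 1)) * ∫ g : Matrix.specialUnitaryGroup (Fin 2) ℂ, (su2Quat g).re ^ (k + n) ∂(haarProbability (Matrix.specialUnitaryGroup (Fin 2) ℂ)) :=
    fun n => (coeff_mem k n (hw n)).1
  have h1 := partial_mono ht htκ hx0 N
  have h2 := partial_add_mono127 hκ hκ' hx0 N
  have e : ∀ s : ℝ, ∑ n ∈ range N, (1 / (n ! * (n + a + 1)) * ∫ g : Matrix.specialUnitaryGroup (Fin 2) ℂ, (su2Quat g).re ^ (k + n) ∂(haarProbability (Matrix.specialUnitaryGroup (Fin 2) ℂ))) * s ^ n =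
      ∑ n ∈ range N, s ^ n / (n ! * (n + a + 1)) * ∫ g : Matrix.specialUnitaryGroup (Fin 2) ℂ, (su2Quat g).re ^ (k + n) ∂(haarProbability (Matrix.specialUnitaryGroup (Fin 2) ℂ)) :=
    fun s => sum_congr rfl fun n _ => by ring
  rw [e, e] at h1 h2
  exact ⟨h1.trans hlo, hhi.trans h2⟩

/-- Every ball moment is non-negative on `0 ≤ κ ≤ 12/7` (empty partial sum). [folklore] -/
theorem ball_nonneg127 (k a : ℕ) {κ : ℝ} (hκ : 0 ≤ κ) (hκ' : κ ≤ 12 / 7) :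
    0 ≤ ∫ r in (0:ℝ)..1, r ^ a * ∫ g : Matrix.specialUnitaryGroup (Fin 2) ℂ, (su2Quat g).re ^ k * Real.exp (κ * r * (su2Quat g).re) ∂(haarProbability (Matrix.specialUnitaryGroup (Fin 2) ℂ)) := by
  simpa using (ball_bracket127 k a hκ hκ' 0).1

/-! ## 2. Numerical brackets on the piece `8/5 ≤ κ ≤ 12/7` -/

/-- **The twelve numerical brackets on the piece `8/5 ≤ κ ≤ 12/7`** (lower partial sums evaluated at `8/5`, upper
ones at `12/7`, `N = 10`, Haar moments `m₀ … m₁₃`): `1356/1000 ≤ Z ≤ 1416/1000`, `492/1000 ≤ Z' ≤ 544/1000`,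
`307/1000 ≤ z_B ≤ 318/1000`, `m₂ ≤ 218/1000`, `78/1000 ≤ J41`, `J52 ≤ 68/1000`, `J72 ≤ 525/10000`, `J63 ≤ 343/10000`,
`J74 ≤ 292/10000`. [folklore] -/
theorem piece_brackets127 {κ : ℝ} (hκ : 8 / 5 ≤ κ) (hκ' : κ ≤ 12 / 7) :
    1356 / 1000 ≤ ∫ g : Matrix.specialUnitaryGroup (Fin 2) ℂ, Real.exp (κ * (su2Quat g).re) ∂(haarProbability (Matrix.specialUnitaryGroup (Fin 2) ℂ)) ∧
    ∫ g : Matrix.specialUnitaryGroup (Fin 2) ℂ, Real.exp (κ * (su2Quat g).re) ∂(haarProbability (Matrix.specialUnitaryGroup (Fin 2) ℂ)) ≤ 1416 / 1000 ∧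
    492 / 1000 ≤ ∫ g : Matrix.specialUnitaryGroup (Fin 2) ℂ, (su2Quat g).re * Real.exp (κ * (su2Quat g).re) ∂(haarProbability (Matrix.specialUnitaryGroup (Fin 2) ℂ)) ∧
    ∫ g : Matrix.specialUnitaryGroup (Fin 2) ℂ, (su2Quat g).re * Real.exp (κ * (su2Quat g).re) ∂(haarProbability (Matrix.specialUnitaryGroup (Fin 2) ℂ)) ≤ 544 / 1000 ∧
    307 / 1000 ≤ ∫ r in (0:ℝ)..1, r ^ 3 * ∫ g : Matrix.specialUnitaryGroup (Fin 2) ℂ, Real.exp (κ * r * (su2Quat g).re) ∂(haarProbability (Matrix.specialUnitaryGroup (Fin 2) ℂ)) ∧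
    ∫ r in (0:ℝ)..1, r ^ 3 * ∫ g : Matrix.specialUnitaryGroup (Fin 2) ℂ, Real.exp (κ * r * (su2Quat g).re) ∂(haarProbability (Matrix.specialUnitaryGroup (Fin 2) ℂ)) ≤ 318 / 1000 ∧
    ∫ r in (0:ℝ)..1, r ^ 5 * ∫ g : Matrix.specialUnitaryGroup (Fin 2) ℂ, Real.exp (κ * r * (su2Quat g).re) ∂(haarProbability (Matrix.specialUnitaryGroup (Fin 2) ℂ)) ≤ 218 / 1000 ∧
    78 / 1000 ≤ ∫ r in (0:ℝ)..1, r ^ 4 * ∫ g : Matrix.specialUnitaryGroup (Fin 2) ℂ, (su2Quat g).re * Real.exp (κ * r * (su2Quat g).re) ∂(haarProbability (Matrix.specialUnitaryGroup (Fin 2) ℂ)) ∧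
    ∫ r in (0:ℝ)..1, r ^ 5 * ∫ g : Matrix.specialUnitaryGroup (Fin 2) ℂ, (su2Quat g).re ^ 2 * Real.exp (κ * r * (su2Quat g).re) ∂(haarProbability (Matrix.specialUnitaryGroup (Fin 2) ℂ)) ≤ 68 / 1000 ∧
    ∫ r in (0:ℝ)..1, r ^ 7 * ∫ g : Matrix.specialUnitaryGroup (Fin 2) ℂ, (su2Quat g).re ^ 2 * Real.exp (κ * r * (su2Quat g).re) ∂(haarProbability (Matrix.specialUnitaryGroup (Fin 2) ℂ)) ≤ 525 / 10000 ∧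
    ∫ r in (0:ℝ)..1, r ^ 6 * ∫ g : Matrix.specialUnitaryGroup (Fin 2) ℂ, (su2Quat g).re ^ 3 * Real.exp (κ * r * (su2Quat g).re) ∂(haarProbability (Matrix.specialUnitaryGroup (Fin 2) ℂ)) ≤ 343 / 10000 ∧
    ∫ r in (0:ℝ)..1, r ^ 7 * ∫ g : Matrix.specialUnitaryGroup (Fin 2) ℂ, (su2Quat g).re ^ 4 * Real.exp (κ * r * (su2Quat g).re) ∂(haarProbability (Matrix.specialUnitaryGroup (Fin 2) ℂ)) ≤ 292 / 10000 := by
  have h85 : (0:ℝ) ≤ 8 / 5 := by norm_num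
  have hZ := sphere_eval127 0 h85 hκ hκ' 10
  have hZp := sphere_eval127 1 h85 hκ hκ' 10
  have hzB := ball_eval127 0 3 h85 hκ hκ' 10
  have hm2 := (ball_eval127 0 5 h85 hκ hκ' 10).2
  have hJ41 := (ball_eval127 1 4 h85 hκ hκ' 10).1
  have hJ52 := (ball_eval127 2 5 h85 hκ hκ' 10).2
  have hJ72 := (ball_eval127 2 7 h85 hκ hκ' 10).2
  have hJ63 := (ball_eval127 3 6 h85 hκ hκ' 10).2
  have hJ74 := (ball_eval127 4 7 h85 hκ hκ' 10).2
  obtain ⟨m0, m1, m2, m3, m4, m5, m6, m7, m8, m9, m10, m11⟩ := moment_table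
  simp only [sum_range_succ, sum_range_zero, Nat.reduceAdd, m0, m1, m2, m3, m4, m5, m6, m7, m8, m9, m10, m11,
    moment_twelve, moment_thirteen, Nat.factorial, Nat.succ_eq_add_one, Nat.reduceMul, Nat.cast_ofNat,
    Nat.cast_one] at hZ hZp hzB hm2 hJ41 hJ52 hJ72 hJ63 hJ74
  simp only [pow_zero, one_mul] at hZ hzB hm2
  simp only [pow_one] at hZp hJ41
  norm_num at hZ hZp hzB hm2 hJ41 hJ52 hJ72 hJ63 hJ74
  exact ⟨by linarith [hZ.1], by linarith [hZ.2], by linarith [hZp.1], by linarith [hZp.2], by linarith [hzB.1],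
    by linarith [hzB.2], by linarith, by linarith, by linarith, by linarith, by linarith, by linarith⟩

/-! ## 3. Symbolic brackets on `0 ≤ κ ≤ 12/7` and the cancellation brackets on the piece -/

/-- `Z` is bracketed by its degree-`8` Taylor polynomial, `0 ≤ κ ≤ 12/7` (tail `(28/5)κ¹⁰/10! = κ¹⁰/648000`).
[folklore] -/
theorem Z_bracket127 {κ : ℝ} (hκ : 0 ≤ κ) (hκ' : κ ≤ 12 / 7) :
    1 + κ ^ 2 / 8 + κ ^ 4 / 192 + κ ^ 6 / 9216 + κ ^ 8 / 737280
      ≤ ∫ g : Matrix.specialUnitaryGroup (Fin 2) ℂ, Real.exp (κ * (su2Quat g).re) ∂(haarProbability (Matrix.specialUnitaryGroup (Fin 2) ℂ)) ∧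
    ∫ g : Matrix.specialUnitaryGroup (Fin 2) ℂ, Real.exp (κ * (su2Quat g).re) ∂(haarProbability (Matrix.specialUnitaryGroup (Fin 2) ℂ))
      ≤ 1 + κ ^ 2 / 8 + κ ^ 4 / 192 + κ ^ 6 / 9216 + κ ^ 8 / 737280 + κ ^ 10 / 648000 := by
  have h := sphere_bracket127 0 hκ hκ' 10
  obtain ⟨m0, m1, m2, m3, m4, m5, m6, m7, m8, m9, -, -⟩ := moment_table
  simp only [sum_range_succ, sum_range_zero, Nat.reduceAdd, m0, m1, m2, m3, m4, m5, m6, m7, m8, m9,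
    Nat.factorial, Nat.succ_eq_add_one, Nat.reduceMul, Nat.cast_ofNat, Nat.cast_one] at h
  simp only [pow_zero, one_mul] at h
  norm_num at h
  constructor <;> linarith [h.1, h.2]

/-- `Z'` is bracketed by its degree-`9` Taylor polynomial, `0 ≤ κ ≤ 12/7`. [folklore] -/
theorem Zp_bracket127 {κ : ℝ} (hκ : 0 ≤ κ) (hκ' : κ ≤ 12 / 7) :
    κ / 4 + κ ^ 3 / 48 + κ ^ 5 / 1536 + κ ^ 7 / 92160 + κ ^ 9 / 8847360
      ≤ ∫ g : Matrix.specialUnitaryGroup (Fin 2) ℂ, (su2Quat g).re * Real.exp (κ * (su2Quat g).re) ∂(haarProbability (Matrix.specialUnitaryGroup (Fin 2) ℂ)) ∧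
    ∫ g : Matrix.specialUnitaryGroup (Fin 2) ℂ, (su2Quat g).re * Real.exp (κ * (su2Quat g).re) ∂(haarProbability (Matrix.specialUnitaryGroup (Fin 2) ℂ))
      ≤ κ / 4 + κ ^ 3 / 48 + κ ^ 5 / 1536 + κ ^ 7 / 92160 + κ ^ 9 / 8847360 + κ ^ 10 / 648000 := by
  have h := sphere_bracket127 1 hκ hκ' 10
  obtain ⟨-, m1, m2, m3, m4, m5, m6, m7, m8, m9, m10, -⟩ := moment_table
  simp only [sum_range_succ, sum_range_zero, Nat.reduceAdd, m1, m2, m3, m4, m5, m6, m7, m8, m9, m10,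
    Nat.factorial, Nat.succ_eq_add_one, Nat.reduceMul, Nat.cast_ofNat, Nat.cast_one] at h
  simp only [pow_one] at h
  norm_num at h
  constructor <;> linarith [h.1, h.2]

/-- `z_B` is bracketed by its degree-`8` polynomial, `0 ≤ κ ≤ 12/7`. [folklore] -/
theorem zB_bracket127 {κ : ℝ} (hκ : 0 ≤ κ) (hκ' : κ ≤ 12 / 7) :
    1 / 4 + κ ^ 2 / 48 + κ ^ 4 / 1536 + κ ^ 6 / 92160 + κ ^ 8 / 8847360
      ≤ ∫ r in (0:ℝ)..1, r ^ 3 * ∫ g : Matrix.specialUnitaryGroup (Fin 2) ℂ, Real.exp (κ * r * (su2Quat g).re) ∂(haarProbability (Matrix.specialUnitaryGroup (Fin 2) ℂ)) ∧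
    ∫ r in (0:ℝ)..1, r ^ 3 * ∫ g : Matrix.specialUnitaryGroup (Fin 2) ℂ, Real.exp (κ * r * (su2Quat g).re) ∂(haarProbability (Matrix.specialUnitaryGroup (Fin 2) ℂ))
      ≤ 1 / 4 + κ ^ 2 / 48 + κ ^ 4 / 1536 + κ ^ 6 / 92160 + κ ^ 8 / 8847360 + κ ^ 10 / 648000 := by
  have h := ball_bracket127 0 3 hκ hκ' 10
  obtain ⟨m0, m1, m2, m3, m4, m5, m6, m7, m8, m9, -, -⟩ := moment_table
  simp only [sum_range_succ, sum_range_zero, Nat.reduceAdd, m0, m1, m2, m3, m4, m5, m6, m7, m8, m9,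
    Nat.factorial, Nat.succ_eq_add_one, Nat.reduceMul, Nat.cast_ofNat, Nat.cast_one] at h
  simp only [pow_zero, one_mul] at h
  norm_num at h
  constructor <;> linarith [h.1, h.2]

/-- **Polynomial bookkeeping on the piece `8/5 ≤ κ ≤ 12/7`.**  From the three symbolic brackets: `1 ≤ Z`, `1/4 ≤ z_B`
and the NUMERICAL cancellation brackets `0 ≤ 4Z' − κZ + κ³Z/20 ≤ 107/1000`, `0 ≤ κZ − 4Z' ≤ 253/1000`,
`123/1000 ≤ Z − 4 z_B` (the cancelling low orders are subtracted symbolically, the surviving monomials are evaluated at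
the end-points). [folklore] -/
theorem cancel_piece127 {κ Z Zp zB : ℝ} (hκ : 8 / 5 ≤ κ) (hκ' : κ ≤ 12 / 7)
    (hZl : 1 + κ ^ 2 / 8 + κ ^ 4 / 192 + κ ^ 6 / 9216 + κ ^ 8 / 737280 ≤ Z)
    (hZu : Z ≤ 1 + κ ^ 2 / 8 + κ ^ 4 / 192 + κ ^ 6 / 9216 + κ ^ 8 / 737280 + κ ^ 10 / 648000)
    (hZpl : κ / 4 + κ ^ 3 / 48 + κ ^ 5 / 1536 + κ ^ 7 / 92160 + κ ^ 9 / 8847360 ≤ Zp)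
    (hZpu : Zp ≤ κ / 4 + κ ^ 3 / 48 + κ ^ 5 / 1536 + κ ^ 7 / 92160 + κ ^ 9 / 8847360 + κ ^ 10 / 648000)
    (hBl : 1 / 4 + κ ^ 2 / 48 + κ ^ 4 / 1536 + κ ^ 6 / 92160 + κ ^ 8 / 8847360 ≤ zB)
    (hBu : zB ≤ 1 / 4 + κ ^ 2 / 48 + κ ^ 4 / 1536 + κ ^ 6 / 92160 + κ ^ 8 / 8847360 + κ ^ 10 / 648000) :
    1 ≤ Z ∧ 1 / 4 ≤ zB ∧
    0 ≤ 4 * Zp - κ * Z + κ ^ 3 * Z / 20 ∧ 4 * Zp - κ * Z + κ ^ 3 * Z / 20 ≤ 107 / 1000 ∧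
    0 ≤ κ * Z - 4 * Zp ∧ κ * Z - 4 * Zp ≤ 253 / 1000 ∧ 123 / 1000 ≤ Z - 4 * zB := by
  have hκ0 : 0 ≤ κ := le_trans (by norm_num) hκ
  -- monomial bounds on the piece
  have u3 : κ ^ 3 ≤ (12 / 7 : ℝ) ^ 3 := pow_le_pow_left₀ hκ0 hκ' 3
  have u5 : κ ^ 5 ≤ (12 / 7 : ℝ) ^ 5 := pow_le_pow_left₀ hκ0 hκ' 5
  have u7 : κ ^ 7 ≤ (12 / 7 : ℝ) ^ 7 := pow_le_pow_left₀ hκ0 hκ' 7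
  have u9 : κ ^ 9 ≤ (12 / 7 : ℝ) ^ 9 := pow_le_pow_left₀ hκ0 hκ' 9
  have u10 : κ ^ 10 ≤ (12 / 7 : ℝ) ^ 10 := pow_le_pow_left₀ hκ0 hκ' 10
  have u11 : κ ^ 11 ≤ (12 / 7 : ℝ) ^ 11 := pow_le_pow_left₀ hκ0 hκ' 11
  have u13 : κ ^ 13 ≤ (12 / 7 : ℝ) ^ 13 := pow_le_pow_left₀ hκ0 hκ' 13
  have l2 : (8 / 5 : ℝ) ^ 2 ≤ κ ^ 2 := pow_le_pow_left₀ (by norm_num) hκ 2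
  have l3 : (8 / 5 : ℝ) ^ 3 ≤ κ ^ 3 := pow_le_pow_left₀ (by norm_num) hκ 3
  have l4 : (8 / 5 : ℝ) ^ 4 ≤ κ ^ 4 := pow_le_pow_left₀ (by norm_num) hκ 4
  have l6 : (8 / 5 : ℝ) ^ 6 ≤ κ ^ 6 := pow_le_pow_left₀ (by norm_num) hκ 6
  have l8 : (8 / 5 : ℝ) ^ 8 ≤ κ ^ 8 := pow_le_pow_left₀ (by norm_num) hκ 8
  norm_num at u3 u5 u7 u9 u10 u11 u13 l2 l3 l4 l6 l8
  obtain ⟨p2, p3, p4, p5, p6, p7⟩ : 0 ≤ κ ^ 2 ∧ 0 ≤ κ ^ 3 ∧ 0 ≤ κ ^ 4 ∧ 0 ≤ κ ^ 5 ∧ 0 ≤ κ ^ 6 ∧ 0 ≤ κ ^ 7 :=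
    ⟨by positivity, by positivity, by positivity, by positivity, by positivity, by positivity⟩
  obtain ⟨p8, p9, p10, p11, p13⟩ : 0 ≤ κ ^ 8 ∧ 0 ≤ κ ^ 9 ∧ 0 ≤ κ ^ 10 ∧ 0 ≤ κ ^ 11 ∧ 0 ≤ κ ^ 13 :=
    ⟨by positivity, by positivity, by positivity, by positivity, by positivity⟩
  -- the products `κ · Z`, `κ³ · Z` against the brackets of `Z`, expanded into monomials
  have e3 : κ * Z ≤ κ + κ ^ 3 / 8 + κ ^ 5 / 192 + κ ^ 7 / 9216 + κ ^ 9 / 737280 + κ ^ 11 / 648000 := by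
    linear_combination mul_le_mul_of_nonneg_left hZu hκ0
  have e4 : κ + κ ^ 3 / 8 + κ ^ 5 / 192 + κ ^ 7 / 9216 + κ ^ 9 / 737280 ≤ κ * Z := by
    linear_combination mul_le_mul_of_nonneg_left hZl hκ0
  have e5 : κ ^ 3 + κ ^ 5 / 8 + κ ^ 7 / 192 + κ ^ 9 / 9216 + κ ^ 11 / 737280 ≤ κ ^ 3 * Z := by
    linear_combination mul_le_mul_of_nonneg_left hZl p3
  have e6 : κ ^ 3 * Z ≤ κ ^ 3 + κ ^ 5 / 8 + κ ^ 7 / 192 + κ ^ 9 / 9216 + κ ^ 11 / 737280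
      + κ ^ 13 / 648000 := by
    linear_combination mul_le_mul_of_nonneg_left hZu p3
  exact ⟨by linarith, by linarith, by linarith, by linarith, by linarith, by linarith, by linarith⟩

end Summit.QuantumFields.BalabanUV.InfraRed.StrongCouplingTwelveSeventhsBrackets
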